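import Summits.AtomisticToContinuum.HydrodynamicLimit.Theorems.ImplosionDichotomyPolynomialCompressionLevel1GroupRTTools

/-!
# Level-1 pointwise bound of the relative-energy method, group RT (pure real inequality)

Helper file for the line `log-lipschitz-budget` of the crux
`ImplosionDichotomy.PolynomialCompression` (stub `stub_logBudgetShadowing`, blueprint §4,
level 1).  At one space-time point let `(a, w, b) = (ρ − c₁³, u − u₁, θ − K c₁²)` be the level-0
difference between a hard-sphere–Euler state and the Type-I reference profile (`ρ₁ = c₁³`,
`θ₁ = K c₁²`, gradients `|du₁|, |dc₁| ≤ C/λ`, second derivatives `|∂²ρ₁|, |∂²θ₁|, |∂²u₁| ≤ R_v`),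
and let `a'ₗ = ∂ₗ δρ`, `w'ₗⱼ = ∂ₗ δuⱼ`, `b'ₗ = ∂ₗ δθ` be its first derivatives (level 1).  With the
weights `A = θ (ζ0 + ζ1)/ρ`, `B = 3ρ/(2θ)`, the level-1 energy
`e₁ = Σₗ ½ (A a'ₗ² + ρ Σⱼ w'ₗⱼ² + B b'ₗ²)` and the weighted level-0 size
`m₀ = √A |a| + √ρ |w| + √B |b|`, the pairing of `(A a'ₗ, B b'ₗ)` with the density and temperature
parts of the differentiated forcing (group RT of the level-1 identity) is at most
`(Λ/λ) e₁ + Γ (1 + λ⁻¹)² (1 + R_v) (1 + c₁ + c₁⁻¹)¹² (1 + K + K⁻¹)¹² (m₀ + σ³) √e₁`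
with `Λ = C (25 + 18 K)` and `Γ = 3 (15 + 4 c_Z + 17 C² c_Z)` (`level1_groupRT_pointwise_bound`).

The bound at a fixed direction `l` is the sum of the two one-direction pairing bounds
`level1_groupRT_density_pairing_le`, `level1_groupRT_temperature_pairing_le` of the file
`…Level1GroupRTTools.lean` (Type-I quadratic terms absorbed into `(Λ/λ) e₁` by weighted AM–GM,
level-1 × level-0 × reference-second-derivative terms paired into `R_v m₀ √e₁`, level-1 ×
EOS-defect terms `ζ0 − 1`, `ζ1 = O(c_Z ρ σ³)` into `σ³ √e₁`); this file dominates all coefficient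
monomials by the envelope `(1 + λ⁻¹)² (1 + R_v) (1 + c₁ + c₁⁻¹)¹² (1 + K + K⁻¹)¹²`
(`rt_envelope`) and sums over `l`.  The weak `C¹` bootstrap hypotheses on `(a', w', b')` are not
needed for this group (it has no cubic terms).  Pure real-number inequality: no torus, no PDE.
-/

namespace Summit.AtomisticToContinuum.HydrodynamicLimit.Theorems

/-! ### Sizes of traces and pairings -/

/-- Trace bound: `|Σᵢ dᵢᵢ| ≤ 3R` when `|dᵢⱼ| ≤ R`. -/
private lemma rt_abs_trace_le {d : Fin 3 → Fin 3 → ℝ} {R : ℝ} (hd : ∀ i j, |d i j| ≤ R) :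
    |∑ i, d i i| ≤ 3 * R := by
  simp only [Fin.sum_univ_three]
  linarith [abs_add_three (d 0 0) (d 1 1) (d 2 2), hd 0 0, hd 1 1, hd 2 2]

/-- Pairing bound: `|Σᵢ wᵢ dᵢ| ≤ 3 N R` when `|wᵢ| ≤ N`, `|dᵢ| ≤ R`. -/
private lemma rt_abs_dot_le {w d : Fin 3 → ℝ} {N R : ℝ} (hN : 0 ≤ N) (hw : ∀ i, |w i| ≤ N)
    (hd : ∀ i, |d i| ≤ R) : |∑ i, w i * d i| ≤ 3 * N * R := by
  have h : ∀ i, |w i * d i| ≤ N * R := fun i => by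
    rw [abs_mul]; exact mul_le_mul (hw i) (hd i) (abs_nonneg _) hN
  simp only [Fin.sum_univ_three]
  linarith [abs_add_three (w 0 * d 0) (w 1 * d 1) (w 2 * d 2), h 0, h 1, h 2]

/-! ### Envelope of the coefficients -/

/-- All coefficient monomials of the linear part are dominated by the envelope
`(1 + L)² (1 + R_v) (1 + c₁ + c₁⁻¹)¹² (1 + K + K⁻¹)¹²`. -/
private lemma rt_envelope {K Ki c₁ ci L Rv C cZ ma mw mb s3 m₀ : ℝ} (hK : 0 < K)
    (hKi0 : 0 < Ki) (hc₁ : 0 < c₁) (hci0 : 0 < ci) (hL : 0 ≤ L) (hRv : 0 ≤ Rv) (hcZ : 0 ≤ cZ)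
    (hma : 0 ≤ ma) (hmw : 0 ≤ mw) (hmb : 0 ≤ mb) (hs3 : 0 ≤ s3) (hm₀ : m₀ = ma + mw + mb) :
    5 * Rv * ma + 9 * (K + 1) * Rv * ci ^ 2 * mw + 6 * (1 + Ki) * Rv * ci * mw + 3 * Rv * mb +
        4 * (K + 1) * c₁ ^ 5 * (1 + c₁) * cZ * Rv * s3 +
        17 * (K + 1) * c₁ ^ 4 * (1 + c₁) * (C * L) ^ 2 * cZ * s3 ≤
      (15 + 4 * cZ + 17 * C ^ 2 * cZ) *
        ((1 + L) ^ 2 * (1 + Rv) * (1 + c₁ + ci) ^ 12 * (1 + K + Ki) ^ 12) * (m₀ + s3) := by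
  subst hm₀
  have hu : 1 ≤ 1 + c₁ + ci := by linarith
  have hv : 1 ≤ 1 + K + Ki := by linarith
  have hpow : ∀ m : ℕ, m ≤ 12 → (1 + c₁ + ci) ^ m ≤ (1 + c₁ + ci) ^ 12 := fun _ hm =>
    pow_le_pow_right₀ hu hm
  -- the four factors of the envelope and what they dominate
  have hp1 : (1 : ℝ) ≤ (1 + L) ^ 2 := one_le_pow₀ (by linarith)
  have hp2 : L ^ 2 ≤ (1 + L) ^ 2 := pow_le_pow_left₀ hL (by linarith) 2
  have hr1 : (1 : ℝ) ≤ (1 + c₁ + ci) ^ 12 := one_le_pow₀ hu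
  have hr2 : ci ^ 2 ≤ (1 + c₁ + ci) ^ 12 :=
    (pow_le_pow_left₀ hci0.le (by linarith) 2).trans (hpow 2 (by norm_num))
  have hr3 : ci ≤ (1 + c₁ + ci) ^ 12 := by
    have h := hpow 1 (by norm_num); rw [pow_one] at h; linarith only [h, hc₁]
  have hr4 : c₁ ^ 5 * (1 + c₁) ≤ (1 + c₁ + ci) ^ 12 := by
    calc c₁ ^ 5 * (1 + c₁) ≤ (1 + c₁ + ci) ^ 5 * (1 + c₁ + ci) :=
          mul_le_mul (pow_le_pow_left₀ hc₁.le (by linarith) 5) (by linarith) (by linarith)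
            (by positivity)
      _ = (1 + c₁ + ci) ^ 6 := by ring
      _ ≤ _ := hpow 6 (by norm_num)
  have hr5 : c₁ ^ 4 * (1 + c₁) ≤ (1 + c₁ + ci) ^ 12 := by
    calc c₁ ^ 4 * (1 + c₁) ≤ (1 + c₁ + ci) ^ 4 * (1 + c₁ + ci) :=
          mul_le_mul (pow_le_pow_left₀ hc₁.le (by linarith) 4) (by linarith) (by linarith)
            (by positivity)
      _ = (1 + c₁ + ci) ^ 5 := by ring
      _ ≤ _ := hpow 5 (by norm_num)
  have ht1 : (1 : ℝ) ≤ (1 + K + Ki) ^ 12 := one_le_pow₀ hv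
  have ht2 : K + 1 ≤ (1 + K + Ki) ^ 12 := by
    have h := pow_le_pow_right₀ hv (show 1 ≤ 12 by norm_num)
    rw [pow_one] at h; linarith only [h, hKi0]
  have ht3 : 1 + Ki ≤ (1 + K + Ki) ^ 12 := by
    have h := pow_le_pow_right₀ hv (show 1 ≤ 12 by norm_num)
    rw [pow_one] at h; linarith only [h, hK]
  clear hpow
  generalize (1 + L) ^ 2 = P at hp1 hp2 ⊢
  generalize (1 + c₁ + ci) ^ 12 = U at hr1 hr2 hr3 hr4 hr5 ⊢
  generalize (1 + K + Ki) ^ 12 = V at ht1 ht2 ht3 ⊢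
  have hP0 : 0 < P := by linarith
  have hU0 : 0 < U := by linarith
  have hV0 : 0 < V := by linarith
  have hRv1 : Rv ≤ 1 + Rv := by linarith
  -- generic monotonicity of a product of four factors
  have mono : ∀ p q r t : ℝ, 0 ≤ q → 0 ≤ r → 0 ≤ t → p ≤ P → q ≤ 1 + Rv → r ≤ U → t ≤ V →
      p * q * r * t ≤ P * (1 + Rv) * U * V := by
    intro p q r t hq hr ht hp' hq' hr' ht'
    have h1 : p * q ≤ P * (1 + Rv) := mul_le_mul hp' hq' hq hP0.le
    have h2 : p * q * r ≤ P * (1 + Rv) * U := mul_le_mul h1 hr' hr (by positivity)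
    exact mul_le_mul h2 ht' ht (by positivity)
  have m1 : Rv ≤ P * (1 + Rv) * U * V := by
    have h := mono 1 Rv 1 1 hRv zero_le_one zero_le_one hp1 hRv1 hr1 ht1; linarith
  have m2 : (K + 1) * Rv * ci ^ 2 ≤ P * (1 + Rv) * U * V := by
    have h := mono 1 Rv (ci ^ 2) (K + 1) hRv (by positivity) (by positivity) hp1 hRv1 hr2 ht2
    linarith
  have m3 : (1 + Ki) * Rv * ci ≤ P * (1 + Rv) * U * V := by
    have h := mono 1 Rv ci (1 + Ki) hRv hci0.le (by positivity) hp1 hRv1 hr3 ht3; linarith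
  have m4 : (K + 1) * c₁ ^ 5 * (1 + c₁) * Rv ≤ P * (1 + Rv) * U * V := by
    have h := mono 1 Rv (c₁ ^ 5 * (1 + c₁)) (K + 1) hRv (by positivity) (by positivity) hp1
      hRv1 hr4 ht2
    linarith
  have m5 : (K + 1) * c₁ ^ 4 * (1 + c₁) * L ^ 2 ≤ P * (1 + Rv) * U * V := by
    have h := mono (L ^ 2) 1 (c₁ ^ 4 * (1 + c₁)) (K + 1) zero_le_one (by positivity)
      (by positivity) hp2 (by linarith) hr5 ht2
    linarith
  have e1 := mul_le_mul_of_nonneg_right m1 hma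
  have e2 := mul_le_mul_of_nonneg_right m2 hmw
  have e3 := mul_le_mul_of_nonneg_right m3 hmw
  have e4 := mul_le_mul_of_nonneg_right m1 hmb
  have e5 := mul_le_mul_of_nonneg_right m4 (mul_nonneg hcZ hs3)
  have e6 := mul_le_mul_of_nonneg_right m5 (by positivity : (0 : ℝ) ≤ C ^ 2 * cZ * s3)
  have f1 : 0 ≤ P * (1 + Rv) * U * V * ma := by positivity
  have f2 : 0 ≤ P * (1 + Rv) * U * V * mb := by positivity
  have f3 : 0 ≤ P * (1 + Rv) * U * V * s3 := by positivity
  have f4 : 0 ≤ cZ * (P * (1 + Rv) * U * V * (ma + mw + mb)) := by positivity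
  have f5 : 0 ≤ C ^ 2 * cZ * (P * (1 + Rv) * U * V * (ma + mw + mb)) := by positivity
  linarith

/-! ### The group bound -/

/-- **Level-1 pointwise bound, group RT** (helper toward `stub_logBudgetShadowing`, line
`log-lipschitz-budget`).  For `K > 0`, `C, C_b, c_Z ≥ 0` there are `Λ, Γ ≥ 0` (we take
`Λ = C (25 + 18 K)`, `Γ = 3 (15 + 4 c_Z + 17 C² c_Z)`) such that at every point of the bootstrap
regime — `a = ρ − c₁³`, `b = θ − K c₁²` within half of the reference values, EOS values
`|ζ0 − 1|, |ζ1|, |ζ2| ≤ c_Z ρ σ³` with `ρ σ³ (c_Z + 1) ≤ 1/8`, Type-I reference gradients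
`|du₁|, |dc₁| ≤ C/λ`, reference second derivatives bounded by `R_v` — the sum over the direction
`l` of the pairings `A a'ₗ · (∂ₗ f_ρ-part) + B b'ₗ · (∂ₗ f_θ-part)` of the level-1 identity is at
most `(Λ/λ) e₁ + Γ (1 + λ⁻¹)² (1 + R_v) (1 + c₁ + c₁⁻¹)¹² (1 + K + K⁻¹)¹² (m₀ + σ³) √e₁`. -/
theorem level1_groupRT_pointwise_bound :
    ∀ (K C Cb cZ : ℝ), 0 < K → 0 ≤ C → 0 ≤ Cb → 0 ≤ cZ →
      ∃ Λ Γ : ℝ, 0 ≤ Λ ∧ 0 ≤ Γ ∧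
        ∀ (lam c₁ ρ θ ζ0 ζ1 ζ2 s3 Rv : ℝ) (du₁ : Fin 3 → Fin 3 → ℝ) (dc₁ : Fin 3 → ℝ)
          (d2ρ₁ d2θ₁ : Fin 3 → Fin 3 → ℝ) (d2u₁ : Fin 3 → Fin 3 → Fin 3 → ℝ)
          (a b : ℝ) (w : Fin 3 → ℝ) (a' b' : Fin 3 → ℝ) (w' : Fin 3 → Fin 3 → ℝ),
          0 < lam → 0 < c₁ → 0 ≤ s3 → 0 ≤ Rv → ρ * s3 * (cZ + 1) ≤ 1 / 8 →
          |ζ0 - 1| ≤ cZ * (ρ * s3) → |ζ1| ≤ cZ * (ρ * s3) → |ζ2| ≤ cZ * (ρ * s3) →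
          a = ρ - c₁ ^ 3 → b = θ - K * c₁ ^ 2 → |a| ≤ c₁ ^ 3 / 2 → |b| ≤ K * c₁ ^ 2 / 2 →
          (∀ i j, |du₁ i j| ≤ C / lam) → (∀ i, |dc₁ i| ≤ C / lam) →
          (∀ i j, |d2ρ₁ i j| ≤ Rv) → (∀ i j, |d2θ₁ i j| ≤ Rv) → (∀ i j k, |d2u₁ i j k| ≤ Rv) →
          (∀ l j, |w' l j| ≤ Cb / lam) → (∀ l, Real.sqrt K * c₁ * |a' l| / c₁ ^ 3 ≤ Cb / lam) →
          (∀ l, |b' l| / (Real.sqrt K * c₁) ≤ Cb / lam) →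
          let A := θ * (ζ0 + ζ1) / ρ
          let B := 3 / 2 * ρ / θ
          let dρ : Fin 3 → ℝ := fun l => 3 * c₁ ^ 2 * dc₁ l + a' l
          let dθ : Fin 3 → ℝ := fun l => 2 * K * c₁ * dc₁ l + b' l
          let D₁ := ∑ i, du₁ i i
          let e₁ := ∑ l, 1 / 2 * (A * (a' l) ^ 2 + ρ * ∑ j, (w' l j) ^ 2 + B * (b' l) ^ 2)
          let m₀ := Real.sqrt A * |a| + Real.sqrt ρ * Real.sqrt (∑ j, (w j) ^ 2) + Real.sqrt B * |b|
          ∑ l, (A * a' l * (-(a' l * D₁) - a * ∑ i, d2u₁ l i i - ∑ i, w' l i * (3 * c₁ ^ 2 * dc₁ i) -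
                ∑ i, w i * d2ρ₁ l i) +
              B * b' l * (-(∑ i, w' l i * (2 * K * c₁ * dc₁ i)) - ∑ i, w i * d2θ₁ l i -
                2 / 3 * (dθ l * ζ0 + θ * (ζ1 / ρ) * dρ l - 2 * K * c₁ * dc₁ l) * D₁ -
                2 / 3 * (θ * ζ0 - K * c₁ ^ 2) * ∑ i, d2u₁ l i i))
            ≤ Λ / lam * e₁ +
              Γ * (1 + lam⁻¹) ^ 2 * (1 + Rv) * (1 + c₁ + c₁⁻¹) ^ 12 * (1 + K + K⁻¹) ^ 12 * (m₀ + s3) *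
                Real.sqrt e₁ := by
  intro K C Cb cZ hK hC _hCb hcZ
  refine ⟨C * (25 + 18 * K), 3 * (15 + 4 * cZ + 17 * C ^ 2 * cZ), by positivity, by positivity,
    ?_⟩
  intro lam c₁ ρ θ ζ0 ζ1 ζ2 s3 Rv du₁ dc₁ d2ρ₁ d2θ₁ d2u₁ a b w a' b' w' hlam hc₁ hs3 hRv hpack hζ0
    hζ1 _hζ2 ha hb haabs hbabs hdu hdc hd2ρ hd2θ hd2u _hw' _ha' _hb' A B dρ dθ D₁ e₁ m₀
  -- freeze the `let`s
  have hAd : A = θ * (ζ0 + ζ1) / ρ := rfl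
  have hBd : B = 3 / 2 * ρ / θ := rfl
  have hdρ : ∀ l, dρ l = 3 * c₁ ^ 2 * dc₁ l + a' l := fun l => rfl
  have hdθ : ∀ l, dθ l = 2 * K * c₁ * dc₁ l + b' l := fun l => rfl
  have hD₁ : D₁ = ∑ i, du₁ i i := rfl
  have he₁ : e₁ = ∑ l, 1 / 2 * (A * a' l ^ 2 + ρ * ∑ j, w' l j ^ 2 + B * b' l ^ 2) := rfl
  have hm₀ : m₀ = Real.sqrt A * |a| + Real.sqrt ρ * Real.sqrt (∑ j, w j ^ 2) +
      Real.sqrt B * |b| := rfl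
  clear_value A B dρ dθ D₁ e₁ m₀
  -- the bootstrap windows
  obtain ⟨ha1, ha2⟩ := abs_le.1 haabs
  obtain ⟨hb1, hb2⟩ := abs_le.1 hbabs
  obtain ⟨hz1, hz2⟩ := abs_le.1 hζ0
  obtain ⟨hy1, hy2⟩ := abs_le.1 hζ1
  have hc3 : 0 < c₁ ^ 3 := by positivity
  have hKc : 0 < K * c₁ ^ 2 := by positivity
  have hρlo : c₁ ^ 3 / 2 ≤ ρ := by linarith
  have hρhi : ρ ≤ 3 * c₁ ^ 3 / 2 := by linarith
  have hθlo : K * c₁ ^ 2 / 2 ≤ θ := by linarith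
  have hθhi : θ ≤ 3 * (K * c₁ ^ 2) / 2 := by linarith
  have hρ : 0 < ρ := by linarith
  have hθ : 0 < θ := by linarith
  have hsmall : cZ * (ρ * s3) ≤ 1 / 8 := by linarith [mul_nonneg hρ.le hs3]
  have hγlo : 3 / 4 ≤ ζ0 + ζ1 := by linarith
  have hγhi : ζ0 + ζ1 ≤ 5 / 4 := by linarith
  have hγ0 : 0 < ζ0 + ζ1 := by linarith
  -- the weights
  have hApos : 0 < A := by rw [hAd]; positivity
  have hBpos : 0 < B := by rw [hBd]; positivity
  have hAρ : A * ρ = θ * (ζ0 + ζ1) := by rw [hAd]; field_simp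
  have hBθ : B * θ = 3 / 2 * ρ := by rw [hBd]; field_simp
  have hAB : A * B = 3 / 2 * (ζ0 + ζ1) := by rw [hAd, hBd]; field_simp
  have hAc4 : A * c₁ ^ 4 ≤ 15 / 2 * K * ρ := by
    have h1 : A * (c₁ ^ 3 / 2) ≤ A * ρ := mul_le_mul_of_nonneg_left hρlo hApos.le
    have h2 : θ * (ζ0 + ζ1) ≤ 3 * (K * c₁ ^ 2) / 2 * (5 / 4) :=
      mul_le_mul hθhi hγhi hγ0.le (by positivity)
    rw [hAρ] at h1
    have h3 : A * c₁ ^ 3 ≤ 15 / 4 * K * c₁ ^ 2 := by linarith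
    linarith [mul_le_mul_of_nonneg_right h3 hc₁.le, mul_le_mul_of_nonneg_left hρlo hK.le]
  have hBK1 : ρ ≤ B * (K * c₁ ^ 2) := by
    have := mul_le_mul_of_nonneg_left hθhi hBpos.le; linarith
  have hBK2 : B * (K * c₁ ^ 2) ≤ 3 * ρ := by
    have := mul_le_mul_of_nonneg_left hθlo hBpos.le; linarith
  -- Type-I and second-derivative sizes, weighted level-0 sizes, energy pieces
  simp only [div_eq_mul_inv] at hdu hdc
  have hL : 0 ≤ lam⁻¹ := inv_nonneg.2 hlam.le
  have hε : 0 ≤ C * lam⁻¹ := by positivity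
  have hD : |D₁| ≤ 3 * (C * lam⁻¹) := by rw [hD₁]; exact rt_abs_trace_le hdu
  have hN0 : 0 ≤ Real.sqrt (∑ j, w j ^ 2) := Real.sqrt_nonneg _
  have hwN : ∀ i, |w i| ≤ Real.sqrt (∑ j, w j ^ 2) := fun i =>
    Real.abs_le_sqrt (Finset.single_le_sum (f := fun j => w j ^ 2) (fun j _ => sq_nonneg (w j))
      (Finset.mem_univ i))
  have hma : (Real.sqrt A * |a|) ^ 2 = A * a ^ 2 := by
    rw [mul_pow, Real.sq_sqrt hApos.le, sq_abs]
  have hmw : (Real.sqrt ρ * Real.sqrt (∑ j, w j ^ 2)) ^ 2 = ρ * Real.sqrt (∑ j, w j ^ 2) ^ 2 := by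
    rw [mul_pow, Real.sq_sqrt hρ.le]
  have hmb : (Real.sqrt B * |b|) ^ 2 = B * b ^ 2 := by
    rw [mul_pow, Real.sq_sqrt hBpos.le, sq_abs]
  have hE : ∀ l, 1 / 2 * (A * a' l ^ 2 + ρ * ∑ j, w' l j ^ 2 + B * b' l ^ 2) ≤ e₁ := fun l => by
    rw [he₁]
    exact Finset.single_le_sum
      (f := fun l => 1 / 2 * (A * a' l ^ 2 + ρ * ∑ j, w' l j ^ 2 + B * b' l ^ 2))
      (fun l _ => by positivity) (Finset.mem_univ l)
  -- the envelope, with the three powers frozen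
  have henv := rt_envelope (C := C) (ma := Real.sqrt A * |a|)
    (mw := Real.sqrt ρ * Real.sqrt (∑ j, w j ^ 2)) (mb := Real.sqrt B * |b|) hK (inv_pos.2 hK)
    hc₁ (inv_pos.2 hc₁) hL hRv hcZ (by positivity) (by positivity) (by positivity) hs3 hm₀
  generalize (1 + lam⁻¹) ^ 2 = P at henv ⊢
  generalize (1 + c₁ + c₁⁻¹) ^ 12 = U at henv ⊢
  generalize (1 + K + K⁻¹) ^ 12 = V at henv ⊢
  refine le_trans (Finset.sum_le_sum (g := fun l =>
    (25 + 18 * K) * (C * lam⁻¹) * (1 / 2 * (A * a' l ^ 2 + ρ * ∑ j, w' l j ^ 2 + B * b' l ^ 2)) +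
      (15 + 4 * cZ + 17 * C ^ 2 * cZ) * (P * (1 + Rv) * U * V) * (m₀ + s3) * Real.sqrt e₁)
    (fun l _ => ?_)) ?_
  · -- the bound at a fixed direction `l`
    have h1 := level1_groupRT_density_pairing_le K (C * lam⁻¹) Rv c₁ c₁⁻¹ ρ A B a (a' l) (b' l)
      D₁ (∑ i, d2u₁ l i i) (∑ i, w i * d2ρ₁ l i) (Real.sqrt (∑ j, w j ^ 2)) (Real.sqrt A * |a|)
      (Real.sqrt ρ * Real.sqrt (∑ j, w j ^ 2)) e₁ (w' l) dc₁ hε hRv hK (mul_inv_cancel₀ hc₁.ne')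
      (inv_pos.2 hc₁) hρ hApos hBpos.le hAc4 hD (rt_abs_trace_le (hd2u l))
      (rt_abs_dot_le hN0 hwN (hd2ρ l)) hdc (by positivity) hma (by positivity) hmw (hE l)
    have h2 := level1_groupRT_temperature_pairing_le K K⁻¹ (C * lam⁻¹) Rv c₁ c₁⁻¹ cZ s3 ρ θ ζ0
      ζ1 A B b (a' l) (b' l) (dc₁ l) (dθ l) (dρ l) D₁ (∑ i, d2u₁ l i i) (∑ i, w i * d2θ₁ l i)
      (Real.sqrt (∑ j, w j ^ 2)) (Real.sqrt ρ * Real.sqrt (∑ j, w j ^ 2)) (Real.sqrt B * |b|)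
      e₁ (w' l) dc₁ hε hRv hK (mul_inv_cancel₀ hK.ne') (inv_pos.2 hK) hc₁
      (mul_inv_cancel₀ hc₁.ne') (inv_pos.2 hc₁) hcZ hs3 hρ hρhi hApos hBpos hBK1 hBK2 hBθ hAB
      hγlo hζ0 hζ1 hsmall hD (rt_abs_trace_le (hd2u l)) (rt_abs_dot_le hN0 hwN (hd2θ l)) hdc
      (hdc l) (hdθ l) (hdρ l) hb (by positivity) hmw (by positivity) hmb (hE l)
    have h5 := mul_le_mul_of_nonneg_right henv (Real.sqrt_nonneg e₁)
    have s1 : 0 ≤ C * lam⁻¹ * (A * a' l ^ 2) := by positivity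
    have s2 : 0 ≤ C * lam⁻¹ * (ρ * ∑ j, w' l j ^ 2) := by positivity
    have s3' : 0 ≤ C * lam⁻¹ * (B * b' l ^ 2) := by positivity
    have s4 : 0 ≤ K * (C * lam⁻¹ * (ρ * ∑ j, w' l j ^ 2)) := by positivity
    have s5 : 0 ≤ K * (C * lam⁻¹ * (B * b' l ^ 2)) := by positivity
    linarith [h1, h2, h5]
  · -- summing over `l`
    rw [Finset.sum_add_distrib, ← Finset.mul_sum, ← he₁, Finset.sum_const, Finset.card_univ,
      Fintype.card_fin, nsmul_eq_mul, Nat.cast_ofNat]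
    apply le_of_eq
    ring

end Summit.AtomisticToContinuum.HydrodynamicLimit.Theorems
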